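import Summits.Ventures.PercRepro.RankLevelSetExplicitLin2KeyL

/-!
# PercRepro — THE LEVEL-11 THEOREM-M ROW OF C-025: THE KEY AT `p = 2 367` (p4, S4 feed)

`proofs/P4-gen18.md`. With THEOREM M's staircase multiplicity the assembled inequality `(P_d)` holds, exactly evaluated, at EVERY
core corank `12 ≤ d ≤ 2059` from `p = 1 555` (it fails at `p = 1 554`, corank `1 085`; the quartic floor is `4 309`, the
saturated one `18 780`). The row is taken at `p = 2 367` = the Chernoff tail `⌈(9(11 + 2^11) + 17·11 + 216)/8⌉` of
RankLevelSetExplicitLin2LevelTail, which now binds: the key `KeyL 11 2367 d` (RankLevelSetExplicitLin2KeyL) is checked by the kernel at the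
2 048 coranks (`decide`, 1 chunk of 2 048). The level step and the unconditional chain are
RankLevelSetExplicitLin2IndepFloor (`c025_eleven_indep_step`, `c025_eleven_indep_from_2367`). Axioms: standard.
-/

namespace PercRepro

namespace ThmN

namespace Explicit

/-- **THE THEOREM-M KEY ROW AT `(q, p) = (11, 2 367)`**: `KeyL 11 2367 d` at every corank `12 ≤ d ≤ 2059`, by the kernel. -/
theorem key_eleven_indep_row : ∀ t < 2048, KeyL 11 2367 (12 + t) := by decide +kernel

/-- **THE KEY'S OWN FLOOR IS `1 555`**: the THEOREM-M key FAILS at `p = 1 554`, corank `1 085`, by the kernel (the row sits at the tail `2 367`). -/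
theorem key_eleven_indep_sharp : ¬ KeyL 11 1554 1085 := by decide +kernel

end Explicit

end ThmN

end PercRepro
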